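import Mathlib.Analysis.SpecialFunctions.Trigonometric.Deriv
import Mathlib.Analysis.InnerProductSpace.Calculus
import Mathlib.Analysis.InnerProductSpace.PiL2
import Mathlib.Analysis.Calculus.Deriv.MeanValue

/-!
# Candidate proof (disprover's evidence, NOT a landing) of `stub_screwIsPeriodic`
# — line `blowdown-kills-pitch`, crux `SymmetricLiouville` (stmt-NavierStokesRegularity-4053)

`Sig.stub_screwIsPeriodic` / `stub_screwIsPeriodic` of the lead's skeleton
(`Cruxes/SymmetricLiouville/Lines/blowdown-kills-pitch.lean`, skeleton `415f7ae75d4c`):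

  `∀ (a : E3) (A : E3 →L[ℝ] E3), (∀ x, ⟪A x, x⟫ = 0) → a ∉ Set.range A →
      ∃ e : E3, e ≠ 0 ∧ ∀ v : E3 → E3, Differentiable ℝ v →
        (∀ x, fderiv ℝ v x (a + A x) = A (v x)) → ∀ x, v (x + e) = v x`

proved sorry-free from Mathlib only ("screw ⊃ lattice"): a skew `A` on `ℝ³` is `x ↦ ω × x`
(`exists_crossE_of_skew`, by polarisation and the matrix entries); if `ω = 0` the clause says
`a·∇v = 0` and `e = a`; if `ω ≠ 0` then `A³ = −ρ²A` (`ρ = |ω|`), the flow of the Killing field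
`a + Ax` is `s ↦ c₀ + E(s)(x − c₀) + s a_∥` with the Rodrigues exponential
`E(s) = 1 + (sin ρs/ρ)A + ((1 − cos ρs)/ρ²)A²`, `A c₀ = −a_⊥`, `a_∥ = (ω·a/ρ²)ω ≠ 0` (because
`a ∉ range A ⊇ ω^⊥`), the clause integrates to `v(flow) = E(s)v(x)` (`w' = Aw`, `w(0) = 0`,
`‖w‖²` constant since `A` is skew), and at `s = 2π/ρ`, `E = 1`: `v(x + (2π/ρ)a_∥) = v(x)`.
Written by the standing disprover (refuter-cdisprove-…-4053-g3); same namespace as the skeleton.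
-/

noncomputable section

open Set Function Filter Topology WithLp
open scoped RealInnerProductSpace

namespace Summit.NavierStokesRegularity.NavierStokesRegularity.Theorems.SymmetryModuliCountSymmetricLiouville

/-- Local notation for physical space `ℝ³`. -/
local notation "E3" => EuclideanSpace ℝ (Fin 3)

/-! ### The cross product on `E3` in coordinates -/

/-- `ω × x`. -/
def crossE (ω x : E3) : E3 :=
  toLp 2 ![ω 1 * x 2 - ω 2 * x 1, ω 2 * x 0 - ω 0 * x 2, ω 0 * x 1 - ω 1 * x 0]

@[simp] theorem crossE_apply_zero (ω x : E3) : crossE ω x 0 = ω 1 * x 2 - ω 2 * x 1 := rfl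
@[simp] theorem crossE_apply_one (ω x : E3) : crossE ω x 1 = ω 2 * x 0 - ω 0 * x 2 := rfl
@[simp] theorem crossE_apply_two (ω x : E3) : crossE ω x 2 = ω 0 * x 1 - ω 1 * x 0 := rfl

/-- `|ω|²` in coordinates. -/
def sqn (ω : E3) : ℝ := ω 0 ^ 2 + ω 1 ^ 2 + ω 2 ^ 2

/-- `ω · a` in coordinates. -/
def dotE (ω a : E3) : ℝ := ω 0 * a 0 + ω 1 * a 1 + ω 2 * a 2

/-- The standard basis vectors. -/
def bv (i : Fin 3) : E3 := EuclideanSpace.single i (1 : ℝ)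

theorem sqn_nonneg (ω : E3) : 0 ≤ sqn ω := by unfold sqn; positivity

theorem sqn_eq_zero_iff (ω : E3) : sqn ω = 0 ↔ ω = 0 := by
  constructor
  · intro h
    unfold sqn at h
    have h0 : ω 0 = 0 := by nlinarith [sq_nonneg (ω 0), sq_nonneg (ω 1), sq_nonneg (ω 2)]
    have h1 : ω 1 = 0 := by nlinarith [sq_nonneg (ω 0), sq_nonneg (ω 1), sq_nonneg (ω 2)]
    have h2 : ω 2 = 0 := by nlinarith [sq_nonneg (ω 0), sq_nonneg (ω 1), sq_nonneg (ω 2)]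
    ext i
    fin_cases i <;> simp [h0, h1, h2]
  · rintro rfl
    simp [sqn]

theorem crossE_zero_left (x : E3) : crossE 0 x = 0 := by
  ext i; fin_cases i <;> simp [crossE]

theorem crossE_self (ω : E3) : crossE ω ω = 0 := by
  ext i; fin_cases i <;> simp [crossE] <;> ring

theorem crossE_smul (ω : E3) (c : ℝ) (x : E3) : crossE ω (c • x) = c • crossE ω x := by
  ext i; fin_cases i <;> simp [crossE] <;> ring

/-- BAC–CAB: `ω × (ω × x) = (ω·x) ω − |ω|² x`. -/
theorem crossE_crossE (ω x : E3) : crossE ω (crossE ω x) = dotE ω x • ω - sqn ω • x := by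
  ext i; fin_cases i <;> simp [crossE, dotE, sqn] <;> ring

/-- `A³ = −ρ²A` for `A = ω × ·`. -/
theorem crossE_triple (ω x : E3) : crossE ω (crossE ω (crossE ω x)) = -sqn ω • crossE ω x := by
  ext i; fin_cases i <;> simp [crossE, sqn] <;> ring

theorem dotE_self (ω : E3) : dotE ω ω = sqn ω := by
  simp only [dotE, sqn]; ring

theorem dotE_sub (ω a b : E3) : dotE ω (a - b) = dotE ω a - dotE ω b := by
  simp only [dotE, PiLp.sub_apply]; ring

theorem dotE_smul (ω : E3) (c : ℝ) (a : E3) : dotE ω (c • a) = c * dotE ω a := by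
  simp only [dotE, PiLp.smul_apply, smul_eq_mul]; ring

/-! ### Normal form of a skew operator on `ℝ³` -/

/-- Coordinates are inner products with the basis. -/
theorem apply_eq_inner_bv (v : E3) (i : Fin 3) : v i = ⟪v, bv i⟫ := by
  simp [bv, EuclideanSpace.inner_single_right]

/-- **Every skew operator on `ℝ³` is a cross product**: `⟪Ax, x⟫ = 0` for all `x` implies
`A x = ω × x` with `ω = (A₂₁, A₀₂, A₁₀)`. -/
theorem exists_crossE_of_skew (A : E3 →L[ℝ] E3) (hA : ∀ x, ⟪A x, x⟫ = 0) :
    ∃ ω : E3, ∀ x, A x = crossE ω x := by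
  have hpol : ∀ x y : E3, ⟪A x, y⟫ = -⟪A y, x⟫ := by
    intro x y
    have h := hA (x + y)
    rw [map_add, inner_add_left, inner_add_right, inner_add_right, hA x, hA y] at h
    linarith
  have d0 : (A (bv 0)) 0 = 0 := by rw [apply_eq_inner_bv]; exact hA (bv 0)
  have d1 : (A (bv 1)) 1 = 0 := by rw [apply_eq_inner_bv]; exact hA (bv 1)
  have d2 : (A (bv 2)) 2 = 0 := by rw [apply_eq_inner_bv]; exact hA (bv 2)
  have s01 : (A (bv 1)) 0 = -(A (bv 0)) 1 := by
    rw [apply_eq_inner_bv, apply_eq_inner_bv, hpol]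
  have s12 : (A (bv 2)) 1 = -(A (bv 1)) 2 := by
    rw [apply_eq_inner_bv, apply_eq_inner_bv, hpol]
  have s20 : (A (bv 0)) 2 = -(A (bv 2)) 0 := by
    rw [apply_eq_inner_bv, apply_eq_inner_bv, hpol]
  refine ⟨toLp 2 ![(A (bv 1)) 2, (A (bv 2)) 0, (A (bv 0)) 1], fun x => ?_⟩
  have hx : x = x 0 • bv 0 + x 1 • bv 1 + x 2 • bv 2 := by
    ext i
    fin_cases i <;> simp [bv]
  conv_lhs => rw [hx]
  simp only [map_add, map_smul]
  ext i
  fin_cases i <;> simp [crossE, d0, d1, d2, s01, s12, s20] <;> ring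

/-! ### The Rodrigues exponential of a skew operator -/

/-- `E(s) y = y + (sin ρs/ρ) A y + ((1 − cos ρs)/ρ²) A² y`. -/
def expA (A : E3 →L[ℝ] E3) (ρ s : ℝ) (y : E3) : E3 :=
  y + (Real.sin (ρ * s) / ρ) • A y + ((1 - Real.cos (ρ * s)) / ρ ^ 2) • A (A y)

theorem expA_zero (A : E3 →L[ℝ] E3) (ρ : ℝ) (y : E3) : expA A ρ 0 y = y := by
  simp [expA]

theorem expA_period (A : E3 →L[ℝ] E3) {ρ : ℝ} (hρ : ρ ≠ 0) (y : E3) :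
    expA A ρ (2 * Real.pi / ρ) y = y := by
  have e : ρ * (2 * Real.pi / ρ) = 2 * Real.pi := by field_simp
  simp only [expA]
  rw [e, Real.sin_two_pi, Real.cos_two_pi]
  simp

/-- `A E(s) y = cos ρs · A y + (sin ρs/ρ) A² y` when `A³ = −ρ² A`. -/
theorem map_expA (A : E3 →L[ℝ] E3) {ρ : ℝ} (hρ : ρ ≠ 0) (hA3 : ∀ y, A (A (A y)) = -(ρ ^ 2) • A y)
    (s : ℝ) (y : E3) :
    A (expA A ρ s y) = Real.cos (ρ * s) • A y + (Real.sin (ρ * s) / ρ) • A (A y) := by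
  have hc : (1 - Real.cos (ρ * s)) / ρ ^ 2 * -(ρ ^ 2) = -(1 - Real.cos (ρ * s)) := by
    field_simp
  simp only [expA, map_add, map_smul, hA3, smul_smul, hc]
  module

/-- `d/ds E(s) y = A E(s) y`. -/
theorem hasDerivAt_expA (A : E3 →L[ℝ] E3) {ρ : ℝ} (hρ : ρ ≠ 0)
    (hA3 : ∀ y, A (A (A y)) = -(ρ ^ 2) • A y) (y : E3) (s : ℝ) :
    HasDerivAt (fun σ => expA A ρ σ y) (A (expA A ρ s y)) s := by
  have hlin : HasDerivAt (fun σ : ℝ => ρ * σ) ρ s := by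
    simpa using (hasDerivAt_id s).const_mul ρ
  have h1 : HasDerivAt (fun σ => Real.sin (ρ * σ) / ρ) (Real.cos (ρ * s)) s := by
    refine (((Real.hasDerivAt_sin (ρ * s)).comp s hlin).div_const ρ).congr_deriv ?_
    field_simp
  have h2 : HasDerivAt (fun σ => (1 - Real.cos (ρ * σ)) / ρ ^ 2) (Real.sin (ρ * s) / ρ) s := by
    refine ((((Real.hasDerivAt_cos (ρ * s)).comp s hlin).const_sub 1).div_const (ρ ^ 2)).congr_deriv
      ?_
    rw [div_eq_div_iff (pow_ne_zero 2 hρ) hρ]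
    ring
  have h := ((h1.smul_const (A y)).const_add y).add (h2.smul_const (A (A y)))
  rw [map_expA A hρ hA3]
  exact h

/-! ### The stub -/

/-- **Stub 1 of the skeleton, verbatim signature** (`Sig.stub_screwIsPeriodic` unfolded):
screw ⊃ lattice. -/
theorem stub_screwIsPeriodic_proof :
    ∀ (a : E3) (A : E3 →L[ℝ] E3), (∀ x, ⟪A x, x⟫ = 0) → a ∉ Set.range A →
      ∃ e : E3, e ≠ 0 ∧ ∀ v : E3 → E3, Differentiable ℝ v →
        (∀ x, fderiv ℝ v x (a + A x) = A (v x)) → ∀ x, v (x + e) = v x := by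
  intro a A hA hra
  obtain ⟨ω, hω⟩ := exists_crossE_of_skew A hA
  by_cases hω0 : sqn ω = 0
  · -- `ω = 0`, `A = 0`: the clause is `a·∇v = 0`, the period is `a`
    have hωz : ω = 0 := (sqn_eq_zero_iff ω).1 hω0
    have hAz : ∀ x, A x = 0 := fun x => by rw [hω, hωz, crossE_zero_left]
    have ha : a ≠ 0 := fun h => hra ⟨0, by rw [hAz, h]⟩
    refine ⟨a, ha, fun v hv hcl x => ?_⟩
    have hd : ∀ t : ℝ, HasDerivAt (fun s : ℝ => v (x + s • a)) 0 t := by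
      intro t
      have h1 : HasDerivAt (fun s : ℝ => x + s • a) a t := by
        simpa using ((hasDerivAt_id t).smul_const a).const_add x
      have h2 := (hv (x + t • a)).hasFDerivAt.comp_hasDerivAt t h1
      have e : fderiv ℝ v (x + t • a) a = 0 := by
        have := hcl (x + t • a)
        rwa [hAz, hAz, add_zero] at this
      rwa [e] at h2
    have hconst := is_const_of_deriv_eq_zero (fun s => (hd s).differentiableAt)
      (fun s => (hd s).deriv) 1 0
    simpa using hconst
  · -- `ω ≠ 0`: the screw
    have hρ2 : 0 < sqn ω := lt_of_le_of_ne (sqn_nonneg ω) (Ne.symm hω0)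
    set ρ : ℝ := Real.sqrt (sqn ω) with hρdef
    have hρ : 0 < ρ := Real.sqrt_pos.2 hρ2
    have hρsq : ρ ^ 2 = sqn ω := Real.sq_sqrt hρ2.le
    have hA3 : ∀ y, A (A (A y)) = -(ρ ^ 2) • A y := by
      intro y
      simp only [hω]
      rw [hρsq]
      exact crossE_triple ω y
    -- decomposition of `a` along `ω`
    set κ : ℝ := dotE ω a / sqn ω with hκdef
    set apar : E3 := κ • ω with hapar
    set aperp : E3 := a - apar with haperp
    have hdot : dotE ω a ≠ 0 := by
      intro h0
      apply hra
      refine ⟨(-(sqn ω)⁻¹) • crossE ω a, ?_⟩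
      rw [hω, crossE_smul, crossE_crossE, h0, zero_smul, zero_sub, smul_neg, neg_smul, neg_neg,
        inv_smul_smul₀ hω0]
    have hκ : κ ≠ 0 := div_ne_zero hdot hω0
    have hωne : ω ≠ 0 := fun h => hω0 ((sqn_eq_zero_iff ω).2 h)
    have hapar_ne : apar ≠ 0 := smul_ne_zero hκ hωne
    have hAapar : A apar = 0 := by rw [hω, hapar, crossE_smul, crossE_self, smul_zero]
    have hdot_perp : dotE ω aperp = 0 := by
      rw [haperp, dotE_sub, hapar, dotE_smul, dotE_self, hκdef, div_mul_cancel₀ _ hω0, sub_self]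
    set c0 : E3 := (sqn ω)⁻¹ • crossE ω aperp with hc0
    have hAc0 : A c0 = -aperp := by
      rw [hω, hc0, crossE_smul, crossE_crossE, hdot_perp, zero_smul, zero_sub, smul_neg,
        inv_smul_smul₀ hω0]
    -- the period vector
    refine ⟨(2 * Real.pi / ρ) • apar, smul_ne_zero (div_ne_zero (by positivity) hρ.ne') hapar_ne,
      fun v hv hcl x => ?_⟩
    -- the orbit of the Killing field `a + A·` through `x`
    set γ : ℝ → E3 := fun s => c0 + expA A ρ s (x - c0) + s • apar with hγ
    have hγd : ∀ s, HasDerivAt γ (a + A (γ s)) s := by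
      intro s
      have h1 := hasDerivAt_expA A hρ.ne' hA3 (x - c0) s
      have h2 : HasDerivAt (fun σ : ℝ => σ • apar) apar s := by
        simpa using (hasDerivAt_id s).smul_const apar
      have h := (h1.const_add c0).add h2
      refine h.congr_deriv ?_
      rw [hγ]
      simp only [map_add, map_smul, hAc0, hAapar, smul_zero, add_zero]
      rw [haperp]
      abel
    -- `w = v ∘ γ − E(·) v(x)` solves `w' = A w`, `w 0 = 0`
    set w : ℝ → E3 := fun s => v (γ s) - expA A ρ s (v x) with hw
    have hwd : ∀ s, HasDerivAt w (A (w s)) s := by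
      intro s
      have hu1 : HasDerivAt (fun σ => v (γ σ)) (fderiv ℝ v (γ s) (a + A (γ s))) s :=
        (hv (γ s)).hasFDerivAt.comp_hasDerivAt s (hγd s)
      rw [hcl (γ s)] at hu1
      have hu2 := hasDerivAt_expA A hρ.ne' hA3 (v x) s
      have h3 := hu1.sub hu2
      rwa [← map_sub] at h3
    have hn : ∀ s, HasDerivAt (fun σ => ⟪w σ, w σ⟫) 0 s := by
      intro s
      have h1 := (hwd s).inner ℝ (hwd s)
      have e : ⟪w s, A (w s)⟫ + ⟪A (w s), w s⟫ = 0 := by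
        rw [real_inner_comm, hA, add_zero]
      rwa [e] at h1
    have hconst : ∀ s, ⟪w s, w s⟫ = ⟪w 0, w 0⟫ := fun s =>
      is_const_of_deriv_eq_zero (fun σ => (hn σ).differentiableAt) (fun σ => (hn σ).deriv) s 0
    have hw0 : w 0 = 0 := by
      simp [hw, hγ, expA_zero]
    have hwT : w (2 * Real.pi / ρ) = 0 := by
      have h1 := hconst (2 * Real.pi / ρ)
      rw [hw0, inner_zero_left, real_inner_self_eq_norm_sq] at h1
      have : ‖w (2 * Real.pi / ρ)‖ = 0 := by nlinarith [norm_nonneg (w (2 * Real.pi / ρ))]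
      exact norm_eq_zero.1 this
    have key : v (γ (2 * Real.pi / ρ)) - expA A ρ (2 * Real.pi / ρ) (v x) = 0 := hwT
    rw [expA_period A hρ.ne', sub_eq_zero, hγ] at key
    simp only [expA_period A hρ.ne'] at key
    have e : c0 + (x - c0) + (2 * Real.pi / ρ) • apar = x + (2 * Real.pi / ρ) • apar := by abel
    rw [e] at key
    exact key

end Summit.NavierStokesRegularity.NavierStokesRegularity.Theorems.SymmetryModuliCountSymmetricLiouville

end
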